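import Mathlib
import Literature.Analysis.Calculus.SmoothCutoff
import Literature.Analysis.FluidPDE.PeriodicCylinderGaussGreen
import HarnessLib

/-!
# One-variable cut-off profiles for the flux-sign stub

Third tools file for `stub_fluxSign` of
`Summit.AnomalousDissipation.AnomalousDissipation.Theses.DyadicWallCascade.DyadicRealisation`
(line Sketch).  From Mathlib's `Real.smoothTransition` `S` (smooth, monotone, `= 0` on `t ≤ 0`,
`= 1` on `t ≥ 1`) we build, and record the elementary properties of,

* `S' = deriv S ≥ 0`, supported in `[0, 1]`, `∫ S' = 1`;
* the two-cell partition-of-unity profile `κ(t) = S(t) − S(t−1)` (`κ ≥ 0`, `supp κ ⊆ [0,2]`,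
  `κ(t) + κ(t+1) = 1` on `[0,1]`);
* the horizontal plateaux `χ_R(t) = S(t+R) − S(t−R) = Σ_{j<2R} κ(t+R−j)` with
  `χ_R' = S'(·+R) − S'(·−R)`;
* the vertical edge bumps `ρ_b(s) = b S'(1 + b(1−s)) ≥ 0` (supported in `(1, 1+1/b)`, `∫ρ_b = 1`)
  and the even vertical plateaux `θ_b(s) = S(1+b(1−s)) S(1+b(1+s)) ∈ [0,1]` (`= 1` on `[-1,1]`,
  supported in `|s| ≤ 1 + 1/b`) with `θ_b'(s) = ρ_b(−s) − ρ_b(s)`.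

Everything is packaged in one existential statement `fluxSign_profiles`, which is also the
registered tools stub `stub_fluxSignTools3`. All statements are folklore calculus.
-/

open MeasureTheory Set Filter Topology Function
open Literature.Analysis.Calculus Literature.Analysis.FluidPDE
open scoped BigOperators

set_option linter.dupNamespace false

namespace Summit.AnomalousDissipation.AnomalousDissipation.Theorems

/-- `deriv S` vanishes off `(0, 1)` (`S` is constant on `t ≤ 0` and on `t ≥ 1`; tree lemmas
`deriv_smoothTransition_of_nonpos`, `deriv_smoothTransition_of_one_le`). [folklore] -/
theorem fluxSign_S_deriv_support (t : ℝ) (ht : deriv Real.smoothTransition t ≠ 0) :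
    0 < t ∧ t < 1 := by
  constructor
  · by_contra h
    exact ht (deriv_smoothTransition_of_nonpos (not_lt.1 h))
  · by_contra h
    exact ht (deriv_smoothTransition_of_one_le (not_lt.1 h))

/-- `∫ S' = S(1) − S(0) = 1`. [folklore] -/
theorem fluxSign_S_deriv_integral : ∫ t, deriv Real.smoothTransition t = 1 := by
  have hsupp : support (deriv Real.smoothTransition) ⊆ Ioc (0 : ℝ) 1 := fun t ht =>
    let h := fluxSign_S_deriv_support t (mem_support.1 ht)
    ⟨h.1, h.2.le⟩
  rw [← intervalIntegral.integral_eq_integral_of_support_subset hsupp,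
    intervalIntegral.integral_deriv_eq_sub (fun x _ =>
      (Real.smoothTransition.contDiff (n := ⊤)).differentiable (by simp) x)
      (continuous_deriv_smoothTransition.intervalIntegrable 0 1),
    Real.smoothTransition.one, Real.smoothTransition.zero, sub_zero]

/-- **The profile package.** Existence of the one-variable profiles `S'`, `κ`, `χ_R`, `ρ_b`, `θ_b`
with all the properties used by the flux-sign argument (see the module docstring). [folklore] -/
theorem fluxSign_profiles :
    ∃ (S1 κ : ℝ → ℝ) (χ : ℕ → ℝ → ℝ) (ρ θ : ℝ → ℝ → ℝ),
      (Continuous S1 ∧ HasCompactSupport S1 ∧ (∀ t, 0 ≤ S1 t) ∧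
        (∀ t, S1 t ≠ 0 → 0 < t ∧ t < 1) ∧ ∫ t, S1 t = 1) ∧
      (Continuous κ ∧ HasCompactSupport κ ∧ (∀ t, 0 ≤ κ t) ∧ (∀ t, t ≤ 0 → κ t = 0) ∧
        (∀ t, 2 ≤ t → κ t = 0) ∧ (∀ t, 0 ≤ t → t ≤ 1 → κ t + κ (t + 1) = 1)) ∧
      (∀ R : ℕ, ContDiff ℝ ((⊤ : ℕ∞) : WithTop ℕ∞) (χ R) ∧ HasCompactSupport (χ R) ∧
        (∀ t, 0 ≤ χ R t ∧ χ R t ≤ 1) ∧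
        (∀ t, χ R t = ∑ j ∈ Finset.range (2 * R), κ (t + (R : ℝ) - (j : ℝ))) ∧
        (∀ t, deriv (χ R) t = S1 (t + R) - S1 (t - R))) ∧
      (∀ b : ℝ, 1 ≤ b → Continuous (ρ b) ∧ (∀ s, 0 ≤ ρ b s) ∧
        (∀ s, ρ b s ≠ 0 → 1 < s ∧ s < 1 + b⁻¹) ∧ (∫ s, ρ b s = 1) ∧
        ContDiff ℝ ((⊤ : ℕ∞) : WithTop ℕ∞) (θ b) ∧ HasCompactSupport (θ b) ∧
        (∀ s, 0 ≤ θ b s ∧ θ b s ≤ 1) ∧ (∀ s, θ b s ≠ 0 → |s| ≤ 2) ∧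
        (∀ s, deriv (θ b) s = ρ b (-s) - ρ b s)) := by
  set S := Real.smoothTransition with hS
  set S1 := deriv Real.smoothTransition with hS1
  have hSc : ContDiff ℝ ((⊤ : ℕ∞) : WithTop ℕ∞) S := Real.smoothTransition.contDiff
  have hSmono : Monotone S := Real.smoothTransition.monotone
  have hS0 : ∀ t, t ≤ 0 → S t = 0 := fun t => Real.smoothTransition.zero_of_nonpos
  have hS1' : ∀ t, 1 ≤ t → S t = 1 := fun t => Real.smoothTransition.one_of_one_le
  have hSnn : ∀ t, 0 ≤ S t := Real.smoothTransition.nonneg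
  have hSle : ∀ t, S t ≤ 1 := Real.smoothTransition.le_one
  refine ⟨S1, fun t => S t - S (t - 1), fun R t => S (t + R) - S (t - R),
    fun b s => b * S1 (1 + b * (1 - s)), fun b s => S (1 + b * (1 - s)) * S (1 + b * (1 + s)),
    ⟨continuous_deriv_smoothTransition, ?_, fun t => Real.smoothTransition.monotone.deriv_nonneg,
      fluxSign_S_deriv_support, fluxSign_S_deriv_integral⟩, ⟨?_, ?_, ?_, ?_, ?_, ?_⟩, fun R => ⟨?_, ?_, ?_, ?_, ?_⟩,
    fun b hb => ?_⟩
  -- `S1` has compact support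
  · refine HasCompactSupport.of_support_subset_isCompact (isCompact_Icc (a := (0 : ℝ)) (b := 1))
      fun t ht => ?_
    have h := fluxSign_S_deriv_support t (mem_support.1 ht)
    exact ⟨h.1.le, h.2.le⟩
  -- `κ`
  · exact Real.smoothTransition.continuous.sub
      (Real.smoothTransition.continuous.comp (continuous_sub_right 1))
  · refine HasCompactSupport.of_support_subset_isCompact (isCompact_Icc (a := (0 : ℝ)) (b := 2))
      fun t ht => ?_
    rw [mem_support] at ht
    constructor
    · by_contra h
      refine ht ?_
      show S t - S (t - 1) = 0
      rw [hS0 t (not_le.1 h).le, hS0 (t - 1) (by linarith [not_le.1 h]), sub_zero]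
    · by_contra h
      refine ht ?_
      show S t - S (t - 1) = 0
      rw [hS1' t (by linarith [not_le.1 h]), hS1' (t - 1) (by linarith [not_le.1 h]), sub_self]
  · intro t; exact sub_nonneg.2 (hSmono (by linarith))
  · intro t ht
    show S t - S (t - 1) = 0
    rw [hS0 t ht, hS0 (t - 1) (by linarith), sub_zero]
  · intro t ht
    show S t - S (t - 1) = 0
    rw [hS1' t (by linarith), hS1' (t - 1) (by linarith), sub_self]
  · intro t h0 h1
    show S t - S (t - 1) + (S (t + 1) - S (t + 1 - 1)) = 1
    rw [add_sub_cancel_right, hS1' (t + 1) (by linarith), hS0 (t - 1) (by linarith)]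
    ring
  -- `χ R`
  · exact (hSc.comp (contDiff_id.add contDiff_const)).sub (hSc.comp (contDiff_id.sub contDiff_const))
  · refine HasCompactSupport.of_support_subset_isCompact
      (isCompact_Icc (a := (-(R : ℝ))) (b := R + 1)) fun t ht => ?_
    rw [mem_support] at ht
    have hR : (0 : ℝ) ≤ R := Nat.cast_nonneg R
    constructor
    · by_contra h
      refine ht ?_
      show S (t + R) - S (t - R) = 0
      rw [hS0 _ (by linarith [not_le.1 h]), hS0 _ (by linarith [not_le.1 h]), sub_zero]
    · by_contra h
      refine ht ?_
      show S (t + R) - S (t - R) = 0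
      rw [hS1' _ (by linarith [not_le.1 h]), hS1' _ (by linarith [not_le.1 h]), sub_self]
  · intro t
    refine ⟨sub_nonneg.2 (hSmono (by linarith [(Nat.cast_nonneg R : (0 : ℝ) ≤ R)])), ?_⟩
    linarith [hSle (t + R), hSnn (t - R)]
  · intro t
    have := Finset.sum_range_sub' (fun j : ℕ => S (t + R - j)) (2 * R)
    simp only [Nat.cast_zero, sub_zero, Nat.cast_mul, Nat.cast_ofNat] at this
    rw [show t + R - 2 * (R : ℝ) = t - R by ring] at this
    show S (t + R) - S (t - R) = ∑ j ∈ Finset.range (2 * R), (S (t + R - j) - S (t + R - j - 1))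
    rw [← this]
    refine Finset.sum_congr rfl fun j _ => ?_
    rw [Nat.cast_succ, sub_add_eq_sub_sub]
  · intro t
    have h1 : HasDerivAt (fun x => S (x + R)) (S1 (t + R)) t :=
      HasDerivAt.comp_add_const t R (hasDerivAt_smoothTransition (t + R))
    have h2 : HasDerivAt (fun x => S (x - R)) (S1 (t - R)) t :=
      HasDerivAt.comp_sub_const t R (hasDerivAt_smoothTransition (t - R))
    exact (h1.sub h2).deriv
  -- `ρ b`, `θ b`
  · have hb0 : 0 < b := by linarith
    have hbinv : b * b⁻¹ = 1 := mul_inv_cancel₀ hb0.ne'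
    -- support of `ρ`
    have hρsupp : ∀ s, b * S1 (1 + b * (1 - s)) ≠ 0 → 1 < s ∧ s < 1 + b⁻¹ := by
      intro s hs
      have h := fluxSign_S_deriv_support _ (right_ne_zero_of_mul hs)
      constructor
      · by_contra h'
        have : 0 ≤ b * (1 - s) := mul_nonneg hb0.le (by linarith [not_lt.1 h'])
        linarith [h.2]
      · by_contra h'
        have h'' : b⁻¹ ≤ s - 1 := by linarith [not_lt.1 h']
        have : 1 ≤ b * (s - 1) := by
          calc (1 : ℝ) = b * b⁻¹ := hbinv.symm
            _ ≤ b * (s - 1) := mul_le_mul_of_nonneg_left h'' hb0.le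
        linarith [h.1]
    -- the edge `ζ(s) = S(1 + b(1 - s))` and its derivative
    have hζ : ∀ s, HasDerivAt (fun x => S (1 + b * (1 - x))) (-(b * S1 (1 + b * (1 - s)))) s := by
      intro s
      have hin : HasDerivAt (fun x : ℝ => 1 + b * (1 - x)) (b * -1) s :=
        (((hasDerivAt_id s).const_sub 1).const_mul b).const_add 1
      have := (hasDerivAt_smoothTransition (1 + b * (1 - s))).comp s hin
      refine this.congr_deriv ?_
      ring
    have hζ' : ∀ s, HasDerivAt (fun x => S (1 + b * (1 + x))) (b * S1 (1 + b * (1 - -s))) s := by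
      intro s
      have hin : HasDerivAt (fun x : ℝ => 1 + b * (1 + x)) (b * 1) s :=
        (((hasDerivAt_id s).const_add 1).const_mul b).const_add 1
      have := (hasDerivAt_smoothTransition (1 + b * (1 + s))).comp s hin
      refine this.congr_deriv ?_
      rw [sub_neg_eq_add]; ring
    refine ⟨continuous_const.mul (continuous_deriv_smoothTransition.comp
        (continuous_const.add (continuous_const.mul (continuous_const.sub continuous_id)))),
      fun s => mul_nonneg hb0.le Real.smoothTransition.monotone.deriv_nonneg, hρsupp, ?_, ?_, ?_, ?_, ?_, ?_⟩
    -- `∫ ρ = 1`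
    · have hsupp : support (fun s => b * S1 (1 + b * (1 - s))) ⊆ Ioc 1 (1 + b⁻¹) := fun s hs =>
        let h := hρsupp s (mem_support.1 hs)
        ⟨h.1, h.2.le⟩
      rw [← intervalIntegral.integral_eq_integral_of_support_subset hsupp]
      have hcont : Continuous fun s => b * S1 (1 + b * (1 - s)) :=
        continuous_const.mul (continuous_deriv_smoothTransition.comp
          (continuous_const.add (continuous_const.mul (continuous_const.sub continuous_id))))
      have key := intervalIntegral.integral_eq_sub_of_hasDerivAt (a := 1) (b := 1 + b⁻¹)
        (fun s _ => hζ s) ((hcont.neg).intervalIntegrable _ _)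
      rw [intervalIntegral.integral_neg] at key
      simp only [sub_self, mul_zero, add_zero] at key
      rw [show 1 + b * (1 - (1 + b⁻¹)) = 0 by rw [← hbinv]; ring, hS0 0 le_rfl, hS1' 1 le_rfl] at key
      linarith
    -- smoothness of `θ`
    · exact (hSc.comp (contDiff_const.add (contDiff_const.mul (contDiff_const.sub contDiff_id)))).mul
        (hSc.comp (contDiff_const.add (contDiff_const.mul (contDiff_const.add contDiff_id))))
    -- compact support of `θ`
    · refine HasCompactSupport.of_support_subset_isCompact (isCompact_Icc (a := (-2 : ℝ)) (b := 2))
        fun s hs => ?_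
      rw [mem_support] at hs
      have hbi : b⁻¹ ≤ 1 := inv_le_one_of_one_le₀ hb
      constructor
      · by_contra h
        have h' : s < -2 := not_le.1 h
        have : 1 + b * (1 + s) ≤ 0 := by nlinarith
        exact hs (by show S (1 + b * (1 - s)) * S (1 + b * (1 + s)) = 0; rw [hS0 _ this, mul_zero])
      · by_contra h
        have h' : 2 < s := not_le.1 h
        have : 1 + b * (1 - s) ≤ 0 := by nlinarith
        exact hs (by show S (1 + b * (1 - s)) * S (1 + b * (1 + s)) = 0; rw [hS0 _ this, zero_mul])
    -- `0 ≤ θ ≤ 1`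
    · intro s
      exact ⟨mul_nonneg (hSnn _) (hSnn _), mul_le_one₀ (hSle _) (hSnn _) (hSle _)⟩
    -- support of `θ` within `|s| ≤ 2`
    · intro s hs
      rw [abs_le]
      constructor
      · by_contra h
        have h' : s < -2 := not_le.1 h
        have : 1 + b * (1 + s) ≤ 0 := by nlinarith
        exact hs (by show S (1 + b * (1 - s)) * S (1 + b * (1 + s)) = 0; rw [hS0 _ this, mul_zero])
      · by_contra h
        have h' : 2 < s := not_le.1 h
        have : 1 + b * (1 - s) ≤ 0 := by nlinarith
        exact hs (by show S (1 + b * (1 - s)) * S (1 + b * (1 + s)) = 0; rw [hS0 _ this, zero_mul])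
    -- the derivative of `θ`
    · intro s
      have hθ' : HasDerivAt (fun x => S (1 + b * (1 - x)) * S (1 + b * (1 + x)))
          (-(b * S1 (1 + b * (1 - s))) * S (1 + b * (1 + s)) +
            S (1 + b * (1 - s)) * (b * S1 (1 + b * (1 - -s)))) s :=
        (hζ s).mul (hζ' s)
      rw [hθ'.deriv]
      -- `ρ(s) S(1+b(1+s)) = ρ(s)` and `S(1+b(1-s)) ρ(-s) = ρ(-s)`
      have e1 : b * S1 (1 + b * (1 - s)) * S (1 + b * (1 + s)) = b * S1 (1 + b * (1 - s)) := by
        by_cases h : b * S1 (1 + b * (1 - s)) = 0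
        · rw [h, zero_mul]
        · have hs := (hρsupp s h).1
          rw [hS1' _ (by nlinarith), mul_one]
      have e2 : S (1 + b * (1 - s)) * (b * S1 (1 + b * (1 - -s))) = b * S1 (1 + b * (1 - -s)) := by
        by_cases h : b * S1 (1 + b * (1 - -s)) = 0
        · rw [h, mul_zero]
        · have hs := (hρsupp (-s) h).1
          rw [hS1' _ (by nlinarith), one_mul]
      rw [neg_mul, e1, e2]
      ring

/-- Registered tools stub of `stub_fluxSign` (line Sketch of crux `DyadicRealisation`): the
one-variable profile package. [folklore] -/
theorem stub_fluxSignTools3 :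
    ∃ (S1 κ : ℝ → ℝ) (χ : ℕ → ℝ → ℝ) (ρ θ : ℝ → ℝ → ℝ), (Continuous S1 ∧ HasCompactSupport S1 ∧ (∀
    t, 0 ≤ S1 t) ∧ (∀ t, S1 t ≠ 0 → 0 < t ∧ t < 1) ∧ ∫ t, S1 t = 1) ∧ (Continuous κ ∧
    HasCompactSupport κ ∧ (∀ t, 0 ≤ κ t) ∧ (∀ t, t ≤ 0 → κ t = 0) ∧ (∀ t, 2 ≤ t → κ t = 0) ∧ (∀ t, 0
    ≤ t → t ≤ 1 → κ t + κ (t + 1) = 1)) ∧ (∀ R : ℕ, ContDiff ℝ ((⊤ : ℕ∞) : WithTop ℕ∞) (χ R) ∧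
    HasCompactSupport (χ R) ∧ (∀ t, 0 ≤ χ R t ∧ χ R t ≤ 1) ∧ (∀ t, χ R t = ∑ j ∈ Finset.range (2 *
    R), κ (t + (R : ℝ) - (j : ℝ))) ∧ (∀ t, deriv (χ R) t = S1 (t + R) - S1 (t - R))) ∧ (∀ b : ℝ, 1 ≤
    b → Continuous (ρ b) ∧ (∀ s, 0 ≤ ρ b s) ∧ (∀ s, ρ b s ≠ 0 → 1 < s ∧ s < 1 + b⁻¹) ∧ (∫ s, ρ b s =
    1) ∧ ContDiff ℝ ((⊤ : ℕ∞) : WithTop ℕ∞) (θ b) ∧ HasCompactSupport (θ b) ∧ (∀ s, 0 ≤ θ b s ∧ θ b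
    s ≤ 1) ∧ (∀ s, θ b s ≠ 0 → |s| ≤ 2) ∧ (∀ s, deriv (θ b) s = ρ b (-s) - ρ b s)) :=
  fluxSign_profiles

end Summit.AnomalousDissipation.AnomalousDissipation.Theorems
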